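import Mathlib.Geometry.Manifold.ContMDiff.Atlas
import Mathlib.Geometry.Manifold.MFDeriv.Atlas
import Literature.Topology.Immersions.OpenParallelizableImmersionInduction
import HarnessLib

/-!
# Open parallelizable manifolds immerse in `ℝⁿ`: formal submersions read in a chart

Topic `Literature/Topology/Immersions`; plumbing between the formal-solution bookkeeping on a
framed manifold (`HolonomicNear σ f Ψ U`, `OpenParallelizableImmersionInduction.lean`) and its
Euclidean counterpart in a chart `e` of the maximal `C^∞` atlas (the charts in which handles are
presented, e.g. Morse charts): a pair `(f̂, Â)` of a map `ℝⁿ → ℝⁿ` and a field of continuous linear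
maps on `e.target`. This is the "`Diff`-invariance" of the submersion relation
(Eliashberg–Mishachev 2001, §2.1: natural fibrations, `h_*`) made explicit.

* `Literature.Topology.Immersions.mdifferentiable_of_mem_maximalAtlas'` — a chart of the maximal
  `C^∞` atlas is `MDifferentiable` (both ways), so its differential is an isomorphism
  (`OpenPartialHomeomorph.MDifferentiable.mfderiv`).
* `Literature.Topology.Immersions.linearIndependent_frameDeriv_chart`,
  `continuousOn_frameDeriv_chart` — the frame `σ` read in `e`, `S x = (d e_x (σᵢ x))ᵢ`, is a
  frame of `ℝⁿ` depending continuously on `x ∈ e.source`.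
* `Literature.Topology.Immersions.frameMatrix S` — the linear map `u ↦ ∑ uᵢ Sᵢ`;
  `chartDeriv σ e Ψ y = frameMatrix (Ψ x) ∘ (frameMatrix (S x))⁻¹`, `x = e.symm y`: the formal
  derivative `Ψ` read in the chart, a field of invertible maps continuous on `e.target` with
  `chartDeriv … (e x) (S x i) = Ψ x i`.
* Chain rules: `frameDeriv_comp_chart` (`J_σ(φ ∘ e)(x)ᵢ = Dφ(e x)(S x i)`) and
  `fderiv_comp_symm_apply_frameDeriv_chart` (`D(f ∘ e⁻¹)(e x)(S x i) = J_σ f (x)ᵢ`); hence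
  `chartDeriv_eq_fderiv_of_holonomic`: where `(f, Ψ)` is holonomic, `Â = D(f ∘ e⁻¹)`.
* `Literature.Topology.Immersions.contMDiff_extend_comp_chart` — a `C^∞` map of `ℝⁿ` supported in
  a compact subset of `e.target`, composed with `e` and extended by `0`, is `C^∞` on `M`.

## References

* Y. Eliashberg, N. Mishachev, *Holonomic approximation and Gromov's h-principle*,
  arXiv:math/0101196 (2001), §2.1. [EliashbergMishachev2001]
* J. M. Lee, *Introduction to Smooth Manifolds*, 2nd ed. (2013), Ch. 3 (differentials in
  charts). [LeeSmoothManifolds2013]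
-/

open scoped Manifold ContDiff Topology
open Set Function Filter Bundle Module Metric

noncomputable section

namespace Literature.Topology.Immersions

/-- Local notation: `𝔼 n` is the model Euclidean space `EuclideanSpace ℝ (Fin n)`. -/
local notation "𝔼 " n:arg => EuclideanSpace ℝ (Fin n)

variable {n : ℕ} {M : Type*} [TopologicalSpace M] [ChartedSpace (𝔼 n) M]

/-! ### Charts of the maximal atlas are diffeomorphisms onto their image -/

/-- A chart of the maximal `C^∞` atlas is `MDifferentiable` in the sense of
`OpenPartialHomeomorph.MDifferentiable` (differentiable on its source, with differentiable
inverse on its target). [folklore] -/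
theorem mdifferentiable_of_mem_maximalAtlas' {e : OpenPartialHomeomorph M (𝔼 n)}
    (he : e ∈ IsManifold.maximalAtlas (𝓡 n) ∞ M) : e.MDifferentiable (𝓡 n) (𝓡 n) :=
  ⟨(contMDiffOn_of_mem_maximalAtlas he).mdifferentiableOn (by simp),
    (contMDiffOn_symm_of_mem_maximalAtlas he).mdifferentiableOn (by simp)⟩

section Frame

variable {σ : Fin n → M → 𝔼 n} {e : OpenPartialHomeomorph M (𝔼 n)}

/-- **The frame read in a chart is a frame**: for `x ∈ e.source` the differential `d e_x` is an
isomorphism, so `S x = (d e_x (σᵢ x))ᵢ = frameDeriv σ e x` is linearly independent.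
[folklore] -/
theorem linearIndependent_frameDeriv_chart (he : e ∈ IsManifold.maximalAtlas (𝓡 n) ∞ M)
    (hli : ∀ x, LinearIndependent ℝ fun i => σ i x) {x : M} (hx : x ∈ e.source) :
    LinearIndependent ℝ (frameDeriv σ e x) := by
  set L := (mdifferentiable_of_mem_maximalAtlas' he).mfderiv hx with hL
  have key : LinearIndependent ℝ (L.toLinearEquiv ∘ fun i => σ i x) :=
    (hli x).map' L.toLinearEquiv.toLinearMap L.toLinearEquiv.ker
  exact key

/-- **The frame read in a chart is continuous** on the chart domain: `x ↦ d e_x (σᵢ x)` is the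
second component (`Tℝⁿ = ℝⁿ × ℝⁿ`) of the bundled derivative of `e` applied to the continuous
section `σᵢ` (`ContMDiffOn.continuousOn_tangentMapWithin` on the open source). [folklore] -/
theorem continuousOn_frameDeriv_chart [IsManifold (𝓡 n) ∞ M]
    (he : e ∈ IsManifold.maximalAtlas (𝓡 n) ∞ M)
    (hσ : ∀ i, Continuous fun x => (⟨x, σ i x⟩ : TangentBundle (𝓡 n) M)) :
    ContinuousOn (frameDeriv σ e) e.source := by
  refine continuousOn_pi.2 fun i => ?_
  have hT : ContinuousOn (tangentMapWithin (𝓡 n) (𝓡 n) e e.source)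
      (Bundle.TotalSpace.proj ⁻¹' e.source) :=
    (contMDiffOn_of_mem_maximalAtlas he).continuousOn_tangentMapWithin (by simp)
      e.open_source.uniqueMDiffOn
  have hsec : ContinuousOn (fun x : M => (⟨x, σ i x⟩ : TangentBundle (𝓡 n) M)) e.source :=
    (hσ i).continuousOn
  have hcomp : ContinuousOn (fun x : M => (tangentMapWithin (𝓡 n) (𝓡 n) e e.source
      (⟨x, σ i x⟩ : TangentBundle (𝓡 n) M)).2) e.source := by
    have h2 : Continuous fun p : TangentBundle (𝓡 n) (𝔼 n) => p.2 :=
      (contMDiff_snd_tangentBundle_modelSpace (n := 0) (𝔼 n) (𝓡 n)).continuous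
    exact h2.comp_continuousOn (hT.comp hsec fun x hx => hx)
  refine hcomp.congr fun x hx => ?_
  show frameDeriv σ e x i = (mfderivWithin (𝓡 n) (𝓡 n) e e.source x) (σ i x)
  rw [mfderivWithin_of_mem_nhds (e.open_source.mem_nhds hx)]
  rfl

end Frame

/-! ### The matrix of a family and the formal derivative read in a chart -/

/-- The linear map `u ↦ ∑ᵢ uᵢ • Sᵢ : ℝⁿ → ℝⁿ` attached to a family `S` of `n` vectors of `ℝⁿ`
(its "matrix with columns `Sᵢ`"). [folklore] -/
def frameMatrix (S : Fin n → 𝔼 n) : 𝔼 n →L[ℝ] 𝔼 n :=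
  ∑ i, (EuclideanSpace.proj i : 𝔼 n →L[ℝ] ℝ).smulRight (S i)

/-- `frameMatrix S u = ∑ uᵢ • Sᵢ`. [folklore] -/
theorem frameMatrix_apply (S : Fin n → 𝔼 n) (u : 𝔼 n) : frameMatrix S u = ∑ i, u i • S i := by
  simp only [frameMatrix, FunLike.coe_sum, Finset.sum_apply, ContinuousLinearMap.smulRight_apply]
  rfl

/-- The matrix sends the standard basis vector `eᵢ` to `Sᵢ`. [folklore] -/
theorem frameMatrix_single (S : Fin n → 𝔼 n) (i : Fin n) :
    frameMatrix S (EuclideanSpace.single i 1) = S i := by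
  rw [frameMatrix_apply]
  simp [Finset.sum_ite_eq']

/-- The matrix of a linearly independent family is invertible. [folklore] -/
theorem isInvertible_frameMatrix {S : Fin n → 𝔼 n} (hS : LinearIndependent ℝ S) :
    (frameMatrix S).IsInvertible := by
  refine isInvertible_of_linearIndependent_map ((Fintype.card_fin n).trans
    finrank_euclideanSpace_fin.symm) (frameMatrix S) (v := fun i => EuclideanSpace.single i 1) ?_
  simpa only [frameMatrix_single] using hS

/-- The matrix depends continuously (in fact linearly) on the family. [folklore] -/
theorem continuous_frameMatrix : Continuous (frameMatrix : (Fin n → 𝔼 n) → 𝔼 n →L[ℝ] 𝔼 n) := by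
  unfold frameMatrix
  refine continuous_finsetSum _ fun i _ => ?_
  exact (ContinuousLinearMap.smulRightL ℝ (𝔼 n) (𝔼 n) (EuclideanSpace.proj i)).continuous.comp
    (continuous_apply i)

/-- **The formal derivative read in a chart.** For a family `Ψ` of formal derivatives on the
frame `σ` and a chart `e`, the field of continuous linear maps of `ℝⁿ`
`Â(y) = frameMatrix (Ψ x) ∘ (frameMatrix (S x))⁻¹`, `x = e.symm y`, `S x = frameDeriv σ e x` — the
unique linear map with `Â(e x) (d e_x (σᵢ x)) = Ψ x i`. [cite: EliashbergMishachev2001, §2.1] -/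
def chartDeriv (σ : Fin n → M → 𝔼 n) (e : OpenPartialHomeomorph M (𝔼 n)) (Ψ : M → Fin n → 𝔼 n)
    (y : 𝔼 n) : 𝔼 n →L[ℝ] 𝔼 n :=
  (frameMatrix (Ψ (e.symm y))).comp (frameMatrix (frameDeriv σ e (e.symm y))).inverse

section ChartDeriv

variable {σ : Fin n → M → 𝔼 n} {e : OpenPartialHomeomorph M (𝔼 n)} {Ψ : M → Fin n → 𝔼 n}

/-- The defining property: `Â(e x) (S x i) = Ψ x i` (`x ∈ e.source`). [folklore] -/
theorem chartDeriv_apply_frameDeriv (he : e ∈ IsManifold.maximalAtlas (𝓡 n) ∞ M)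
    (hli : ∀ x, LinearIndependent ℝ fun i => σ i x) {x : M} (hx : x ∈ e.source) (i : Fin n) :
    chartDeriv σ e Ψ (e x) (frameDeriv σ e x i) = Ψ x i := by
  obtain ⟨L, hL⟩ := isInvertible_frameMatrix (linearIndependent_frameDeriv_chart he hli hx)
  have h1 : (frameMatrix (frameDeriv σ e x)).inverse (frameDeriv σ e x i) =
      EuclideanSpace.single i 1 := by
    rw [← hL, ContinuousLinearMap.inverse_equiv]
    show L.symm (frameDeriv σ e x i) = EuclideanSpace.single i 1
    rw [ContinuousLinearEquiv.symm_apply_eq]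
    show _ = (L : 𝔼 n →L[ℝ] 𝔼 n) _
    rw [hL, frameMatrix_single]
  rw [chartDeriv, e.left_inv hx, ContinuousLinearMap.comp_apply, h1, frameMatrix_single]

/-- The formal derivative read in the chart is invertible on `e.target` (both matrices are).
[folklore] -/
theorem isInvertible_chartDeriv (he : e ∈ IsManifold.maximalAtlas (𝓡 n) ∞ M)
    (hli : ∀ x, LinearIndependent ℝ fun i => σ i x) (hΨ : ∀ x, LinearIndependent ℝ (Ψ x))
    {y : 𝔼 n} (hy : y ∈ e.target) : (chartDeriv σ e Ψ y).IsInvertible := by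
  obtain ⟨L, hL⟩ := isInvertible_frameMatrix
    (linearIndependent_frameDeriv_chart he hli (e.map_target hy))
  have h1 : (frameMatrix (frameDeriv σ e (e.symm y))).inverse.IsInvertible := by
    rw [← hL, ContinuousLinearMap.inverse_equiv]
    exact ⟨L.symm, rfl⟩
  exact (isInvertible_frameMatrix (hΨ _)).comp h1

/-- The formal derivative read in the chart is continuous on `e.target` (`Ψ` continuous, `σ` a
continuous frame; inversion is continuous at invertible maps). [folklore] -/
theorem continuousOn_chartDeriv [IsManifold (𝓡 n) ∞ M]
    (he : e ∈ IsManifold.maximalAtlas (𝓡 n) ∞ M)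
    (hσ : ∀ i, Continuous fun x => (⟨x, σ i x⟩ : TangentBundle (𝓡 n) M))
    (hli : ∀ x, LinearIndependent ℝ fun i => σ i x) (hΨ : Continuous Ψ) :
    ContinuousOn (chartDeriv σ e Ψ) e.target := by
  intro y hy
  have hx : e.symm y ∈ e.source := e.map_target hy
  have hsymm : ContinuousWithinAt e.symm e.target y := e.continuousOn_symm y hy
  have h1 : ContinuousWithinAt (fun z => frameMatrix (Ψ (e.symm z))) e.target y :=
    (continuous_frameMatrix.comp hΨ).continuousAt.comp_continuousWithinAt hsymm
  have hS : ContinuousOn (fun x => frameMatrix (frameDeriv σ e x)) e.source :=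
    continuous_frameMatrix.comp_continuousOn (continuousOn_frameDeriv_chart he hσ)
  have h2 : ContinuousWithinAt (fun z => frameMatrix (frameDeriv σ e (e.symm z))) e.target y :=
    ((hS _ hx).continuousAt (e.open_source.mem_nhds hx)).comp_continuousWithinAt hsymm
  obtain ⟨L, hL⟩ := isInvertible_frameMatrix (linearIndependent_frameDeriv_chart he hli hx)
  have hinv : ContinuousAt ContinuousLinearMap.inverse (frameMatrix (frameDeriv σ e (e.symm y))) := by
    rw [← hL]
    exact (contDiffAt_map_inverse (n := 0) L).continuousAt
  exact h1.clm_comp (ContinuousAt.comp_continuousWithinAt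
    (f := fun z => frameMatrix (frameDeriv σ e (e.symm z))) hinv h2)

end ChartDeriv

/-! ### Chain rules through the chart -/

section Chain

variable {σ : Fin n → M → 𝔼 n} {e : OpenPartialHomeomorph M (𝔼 n)}

/-- **Chain rule, forward**: for `φ : ℝⁿ → F'`… here `ℝⁿ → ℝⁿ`, differentiable at `e x`,
`x ∈ e.source`: `J_σ(φ ∘ e)(x)ᵢ = Dφ(e x) (S x i)`. [folklore] -/
theorem frameDeriv_comp_chart (he : e ∈ IsManifold.maximalAtlas (𝓡 n) ∞ M) {x : M}
    (hx : x ∈ e.source) {φ : 𝔼 n → 𝔼 n} (hφ : DifferentiableAt ℝ φ (e x)) (i : Fin n) :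
    frameDeriv σ (fun z => φ (e z)) x i = fderiv ℝ φ (e x) (frameDeriv σ e x i) := by
  have hem : MDifferentiableAt (𝓡 n) (𝓡 n) e x :=
    (mdifferentiable_of_mem_maximalAtlas' he).mdifferentiableAt hx
  have hφm : MDifferentiableAt (𝓡 n) (𝓡 n) φ (e x) := mdifferentiableAt_iff_differentiableAt.2 hφ
  have hchain : mfderiv (𝓡 n) (𝓡 n) (fun z => φ (e z)) x =
      (mfderiv (𝓡 n) (𝓡 n) φ (e x)).comp (mfderiv (𝓡 n) (𝓡 n) e x) := mfderiv_comp x hφm hem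
  rw [frameDeriv_apply, hchain, mfderiv_eq_fderiv]
  rfl

/-- **Chain rule, backward**: `D(f ∘ e⁻¹)(e x) (S x i) = J_σ f (x)ᵢ` for `x ∈ e.source` and `f`
differentiable at `x` (`d e⁻¹ ∘ d e = id`). [folklore] -/
theorem fderiv_comp_symm_apply_frameDeriv_chart (he : e ∈ IsManifold.maximalAtlas (𝓡 n) ∞ M)
    {x : M} (hx : x ∈ e.source) {f : M → 𝔼 n} (hf : MDifferentiableAt (𝓡 n) (𝓡 n) f x)
    (i : Fin n) :
    fderiv ℝ (fun y => f (e.symm y)) (e x) (frameDeriv σ e x i) = frameDeriv σ f x i := by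
  have hE := mdifferentiable_of_mem_maximalAtlas' he
  have hsm : MDifferentiableAt (𝓡 n) (𝓡 n) e.symm (e x) := hE.mdifferentiableAt_symm (e.map_source hx)
  have hf' : MDifferentiableAt (𝓡 n) (𝓡 n) f (e.symm (e x)) := by rwa [e.left_inv hx]
  have hchain : mfderiv (𝓡 n) (𝓡 n) (fun y => f (e.symm y)) (e x) =
      (mfderiv (𝓡 n) (𝓡 n) f (e.symm (e x))).comp (mfderiv (𝓡 n) (𝓡 n) e.symm (e x)) :=
    mfderiv_comp (e x) hf' hsm
  have hid := hE.symm_comp_deriv hx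
  have h2 : (mfderiv (𝓡 n) (𝓡 n) e.symm (e x)) ((mfderiv (𝓡 n) (𝓡 n) e x) (σ i x)) = σ i x := by
    have := DFunLike.congr_fun hid (σ i x)
    exact this
  rw [← mfderiv_eq_fderiv, hchain, frameDeriv_apply, frameDeriv_apply]
  show (mfderiv (𝓡 n) (𝓡 n) f (e.symm (e x)))
      ((mfderiv (𝓡 n) (𝓡 n) e.symm (e x)) ((mfderiv (𝓡 n) (𝓡 n) e x) (σ i x))) = _
  rw [h2, e.left_inv hx]

/-- **Where `(f, Ψ)` is holonomic, its chart reading is holonomic**: if `Ψ x = J_σ f (x)` at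
`x ∈ e.source` then `Â(e x) = D(f ∘ e⁻¹)(e x)` (both agree on the basis `S x`). [folklore] -/
theorem chartDeriv_eq_fderiv_of_eq (he : e ∈ IsManifold.maximalAtlas (𝓡 n) ∞ M)
    (hli : ∀ x, LinearIndependent ℝ fun i => σ i x) {Ψ : M → Fin n → 𝔼 n} {f : M → 𝔼 n}
    {x : M} (hx : x ∈ e.source) (hf : MDifferentiableAt (𝓡 n) (𝓡 n) f x)
    (hΨ : Ψ x = frameDeriv σ f x) :
    chartDeriv σ e Ψ (e x) = fderiv ℝ (fun y => f (e.symm y)) (e x) := by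
  have hb := linearIndependent_frameDeriv_chart he hli hx
  set b : Basis (Fin n) ℝ (𝔼 n) := basisOfLinearIndependentOfCardEqFinrank' _ hb
    ((Fintype.card_fin n).trans finrank_euclideanSpace_fin.symm) with hbdef
  refine ContinuousLinearMap.coe_injective (b.ext fun i => ?_)
  have hbi : b i = frameDeriv σ e x i := by
    rw [hbdef, coe_basisOfLinearIndependentOfCardEqFinrank']
  rw [ContinuousLinearMap.coe_coe, ContinuousLinearMap.coe_coe, hbi,
    chartDeriv_apply_frameDeriv he hli hx, fderiv_comp_symm_apply_frameDeriv_chart he hx hf, hΨ]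

end Chain

/-! ### Extension by zero through a chart -/

open Classical in
/-- **A compactly supported map of the chart, extended by zero.** Let `d : ℝⁿ → F'` be `C^∞`
with topological support inside a compact set `K ⊆ e.target`. Then
`x ↦ if x ∈ e.source then d (e x) else 0` is `C^∞` on `M`: it is `d ∘ e` on the open source and
vanishes on the open complement of the compact set `e.symm '' K`. [folklore] -/
theorem contMDiff_extend_comp_chart [T2Space M] {F' : Type*} [NormedAddCommGroup F']
    [NormedSpace ℝ F'] {e : OpenPartialHomeomorph M (𝔼 n)}
    (he : e ∈ IsManifold.maximalAtlas (𝓡 n) ∞ M) {d : 𝔼 n → F'} (hd : ContDiff ℝ ∞ d)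
    {K : Set (𝔼 n)} (hK : IsCompact K) (hKe : K ⊆ e.target) (hsupp : tsupport d ⊆ K) :
    ContMDiff (𝓡 n) 𝓘(ℝ, F') ∞ fun x => if x ∈ e.source then d (e x) else 0 := by
  classical
  intro x
  by_cases hx : x ∈ e.source
  · -- on the source: `d ∘ e`
    have hev : (fun z => if z ∈ e.source then d (e z) else 0) =ᶠ[𝓝 x] fun z => d (e z) := by
      filter_upwards [e.open_source.mem_nhds hx] with z hz
      simp [hz]
    refine ContMDiffAt.congr_of_eventuallyEq ?_ hev
    exact hd.contMDiff.contMDiffAt.comp x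
      ((contMDiffOn_of_mem_maximalAtlas he).contMDiffAt (e.open_source.mem_nhds hx))
  · -- off the source: `0` near `x`
    have hKM : IsClosed (e.symm '' K) :=
      (hK.image_of_continuousOn (e.continuousOn_symm.mono hKe)).isClosed
    have hxK : x ∉ e.symm '' K := by
      rintro ⟨y, hy, rfl⟩
      exact hx (e.map_target (hKe hy))
    have hev : (fun z => if z ∈ e.source then d (e z) else 0) =ᶠ[𝓝 x] fun _ => 0 := by
      filter_upwards [hKM.isOpen_compl.mem_nhds hxK] with z hz
      by_cases hz' : z ∈ e.source
      · simp only [hz', if_true]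
        apply image_eq_zero_of_notMem_tsupport
        intro hzs
        exact hz ⟨e z, hsupp hzs, e.left_inv hz'⟩
      · simp [hz']
    exact contMDiffAt_const.congr_of_eventuallyEq hev

end Literature.Topology.Immersions
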